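import Literature.Computability.QuantumComplexity.OracleSeparations
import Mathlib.Probability.ProductMeasure
import Mathlib.MeasureTheory.Constructions.Pi
import Mathlib.MeasureTheory.Measure.MeasuredSets
import HarnessLib

/-!
# The random oracle on finitely many coordinates: cylinders, determined events, density

Measure-theoretic toolkit for the tree's random oracle `randomOracleMeasure`
(`OracleSeparations.lean`: Mathlib's `setBer(univ, 1/2)` on `Set (List Bool)`, a uniformly random
language), written for the discharge of Bennett–Gill's `ALMOST-P ⊆ BPP`
(`Literature.Computability.Complexity.almostP_subset_BPP`, file `Complexity/AlmostP.lean`) along the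
classical route (Bennett–Gill 1981; Book–Vollmer–Wagner 1996, Thm. 3: a positive-measure set of
oracles is, after fixing finitely many oracle bits, a set of conditional measure `≥ 2/3`, and a
machine reading finitely many fresh random oracle bits is simulated by coin flips).

* `restrictBool U A : U → Bool` — the bits of the oracle `A` on a finite set `U` of strings;
  **bridge** `randomOracleMeasure_restrictBool`: `μ {A | restrictBool U A ∈ S} = |S| · 2^{-|U|}`,
  i.e. the restriction of the random oracle to `U` is uniform on `U → Bool` (from Mathlib's
  `setBernoulli_apply'`, `infinitePi_map_pi`, `infinitePi_map_restrict`, `pi_singleton`).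
* `IsDetermined U E` — the event `E` depends only on the oracle bits in `U`; such events are
  measurable, have measure `|oracleTrace U E| · 2^{-|U|}`, contain Mathlib's measurable cylinders
  of `List Bool → Prop` (`isDetermined_of_mem_measurableCylinders`; those form a ring of sets
  generating the σ-algebra, `isSetRing_measurableCylinders`, `generateFrom_measurableCylinders`),
  and split along the cylinders `oracleCylinder U τ = {A | restrictBool U A = τ}`
  (`measure_eq_sum`), each of measure `2^{-|U|}` (`measure_oracleCylinder`).
* **Density lemma** `exists_oracleCylinder_diff_le`: if `μ E > 0` then for every `δ > 0` some
  cylinder `C` has `μ (C \ E) ≤ δ · μ C` — approximation of `E` by a measurable cylinder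
  (Mathlib's `exists_measure_symmDiff_lt_of_generateFrom_isSetRing`) followed by a pigeonhole over
  the `oracleCylinder`s of the approximating set. This is the "Lebesgue density" step of Bennett–Gill's
  argument.

## References

* C. H. Bennett, J. Gill, *Relative to a random oracle `A`, `P^A ≠ NP^A ≠ co-NP^A` with
  probability 1*, SIAM J. Comput. 10 (1981) 96–113 [BennettGill1981] (not held: acq-00719).
* R. V. Book, H. Vollmer, K. W. Wagner, *On type-2 probabilistic quantifiers*, ICALP 1996,
  LNCS 1099 [BookVollmerWagner1996], §3 (p. 373: the product measure `μ`), §4 Thm. 3 (p. 374).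
* Mathlib: `ProbabilityTheory.setBernoulli`, `MeasureTheory.Measure.infinitePi`,
  `MeasureTheory.exists_measure_symmDiff_lt_of_generateFrom_isSetRing`.
-/

noncomputable section

open MeasureTheory ProbabilityTheory unitInterval
open scoped ENNReal

namespace Literature.Computability.QuantumComplexity

open Measure

/-! ### The fair coin and the coordinate measures of `setBer(univ, 1/2)` -/

/-- The fair coin on `Bool`: `½ δ_true + ½ δ_false` (the same measure as Mathlib's
`ProbabilityTheory.uniformOn univ`; the Dirac spelling is chosen to feed `Measure.pi_singleton`,
see `coinBool_singleton`). [folklore] -/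
def coinBool : Measure Bool :=
  (2⁻¹ : ℝ≥0∞) • Measure.dirac true + (2⁻¹ : ℝ≥0∞) • Measure.dirac false

/-- The fair coin is a probability measure. [folklore] -/
instance isProbabilityMeasure_coinBool : IsProbabilityMeasure coinBool := by
  refine ⟨?_⟩
  simp [coinBool, ENNReal.inv_two_add_inv_two]

/-- Each face of the fair coin has probability `½`. [folklore] -/
theorem coinBool_singleton (b : Bool) : coinBool {b} = 2⁻¹ := by
  cases b <;> simp [coinBool]

/-- The parameter `1/2 ∈ [0,1]` of `randomOracleMeasure = setBer(univ, 1/2)`. [folklore] -/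
def halfI : I := ⟨1 / 2, by norm_num, by norm_num⟩

/-- `toNNReal (1/2) = 2⁻¹` in `ℝ≥0∞`. [folklore] -/
theorem toNNReal_halfI : (toNNReal halfI : ℝ≥0∞) = 2⁻¹ := by
  have h1 : ((toNNReal halfI : NNReal) : ℝ) = 1 / 2 := rfl
  have h2 : (toNNReal halfI : NNReal) = 2⁻¹ := by
    apply NNReal.coe_injective; rw [h1]; simp
  rw [h2]; simp

/-- `1 - 1/2 = 1/2` in the unit interval. [folklore] -/
theorem symm_halfI : σ halfI = halfI := by
  apply Subtype.ext; simp [halfI]; norm_num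

/-- `randomOracleMeasure` is `setBer(univ, halfI)` (definitional). [folklore] -/
theorem randomOracleMeasure_eq_setBer :
    randomOracleMeasure = setBer((Set.univ : Set (List Bool)), halfI) :=
  rfl

/-- The coordinate measures of `setBer(univ, 1/2)` (Mathlib's definition of `setBernoulli`: at
coordinate `i`, `toNNReal p • δ_{i ∈ univ} + toNNReal (σ p) • δ_False` on `Prop`). [folklore] -/
def coordProp (i : List Bool) : Measure Prop :=
  toNNReal halfI • Measure.dirac (i ∈ (Set.univ : Set (List Bool))) +
    toNNReal (σ halfI) • Measure.dirac False

/-- The coordinate measures are probability measures (Mathlib's instance, by unfolding). [folklore] -/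
instance isProbabilityMeasure_coordProp (i : List Bool) : IsProbabilityMeasure (coordProp i) := by
  unfold coordProp; infer_instance

/-- Pushed to `Bool` by `decide`, each coordinate measure is the fair coin. [folklore] -/
theorem map_decide_coordProp (i : List Bool) :
    (coordProp i).map (fun p : Prop => @decide p (Classical.propDecidable p)) = coinBool := by
  rw [coordProp, symm_halfI, Measure.map_add _ _ (Measurable.of_discrete), Measure.map_smul,
    Measure.map_smul, Measure.map_dirac' (Measurable.of_discrete),
    Measure.map_dirac' (Measurable.of_discrete)]
  have h1 : (@decide (i ∈ (Set.univ : Set (List Bool))) (Classical.propDecidable _)) = true :=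
    @decide_eq_true _ (Classical.propDecidable _) (Set.mem_univ i)
  have h2 : (@decide False (Classical.propDecidable _)) = false :=
    @decide_eq_false _ (Classical.propDecidable _) not_false
  rw [h1, h2, coinBool]
  congr 1 <;> simp [ENNReal.smul_def, toNNReal_halfI]

/-- Coordinatewise `decide : (List Bool → Prop) → (List Bool → Bool)`. [folklore] -/
def decideFun (p : List Bool → Prop) : List Bool → Bool :=
  fun i => @decide (p i) (Classical.propDecidable _)

/-- `decideFun` is measurable (coordinatewise a map out of a discrete space). [folklore] -/
theorem measurable_decideFun : Measurable decideFun :=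
  measurable_pi_lambda _ fun i =>
    (Measurable.of_discrete (f := fun q : Prop => @decide q (Classical.propDecidable q))).comp
      (measurable_pi_apply i)

/-- The product of the coordinate measures, read as Booleans, is the product of fair coins
(Mathlib's `infinitePi_map_pi`). [folklore] -/
theorem map_decideFun_infinitePi_coordProp :
    (infinitePi coordProp).map decideFun = infinitePi fun _ : List Bool => coinBool := by
  have h := infinitePi_map_pi coordProp
    (f := fun (_ : List Bool) (q : Prop) => @decide q (Classical.propDecidable q))
    (fun _ => Measurable.of_discrete)
  refine h.trans ?_
  congr 1
  funext i
  exact map_decide_coordProp i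

/-! ### Restriction to finitely many coordinates: the bridge to counting -/

/-- `restrictBool U A`: the bits `[u ∈ A]` of the oracle `A` at the strings `u ∈ U`, for a finite
set `U` of strings. [folklore] -/
def restrictBool (U : Finset (List Bool)) (A : Set (List Bool)) : U → Bool :=
  fun u => @decide ((u : List Bool) ∈ A) (Classical.propDecidable _)

/-- Unfolding lemma for `restrictBool`. [folklore] -/
theorem restrictBool_apply (U : Finset (List Bool)) (A : Set (List Bool)) (u : U) :
    restrictBool U A u = @decide ((u : List Bool) ∈ A) (Classical.propDecidable _) :=
  rfl

/-- `restrictBool U A u = true ↔ u ∈ A`. [folklore] -/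
theorem restrictBool_eq_true_iff (U : Finset (List Bool)) (A : Set (List Bool)) (u : U) :
    restrictBool U A u = true ↔ (u : List Bool) ∈ A := by
  rw [restrictBool_apply]; exact @decide_eq_true_iff _ (Classical.propDecidable _)

/-- `restrictBool U` is measurable. [folklore] -/
theorem measurable_restrictBool (U : Finset (List Bool)) : Measurable (restrictBool U) := by
  refine measurable_pi_lambda _ fun u => ?_
  refine (Measurable.of_discrete (f := fun q : Prop => @decide q (Classical.propDecidable q))).comp ?_
  exact measurable_set_mem (u : List Bool)

/-- **Bridge.** The random oracle restricted to a finite set `U` of strings is uniform on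
`U → Bool`: `μ {A | restrictBool U A ∈ S} = |S| · 2^{-|U|}` (independent fair bits;
Book–Vollmer–Wagner 1996, §3: "`μ` the product measure based on `μ₀({0}) = μ₀({1}) = ½`").
[cite: BookVollmerWagner1996, §3 (p. 373)] -/
theorem randomOracleMeasure_restrictBool (U : Finset (List Bool)) (S : Finset (U → Bool)) :
    randomOracleMeasure {A | restrictBool U A ∈ S} = S.card * 2⁻¹ ^ U.card := by
  rw [randomOracleMeasure_eq_setBer, setBernoulli_apply']
  have hset : (fun p : List Bool → Prop => {i | p i}) ⁻¹'
      {A : Set (List Bool) | restrictBool U A ∈ S} =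
      decideFun ⁻¹' (U.restrict ⁻¹' (S : Set (U → Bool))) := by
    ext p; rfl
  have hT : MeasurableSet (U.restrict ⁻¹' (S : Set (U → Bool)) : Set (List Bool → Bool)) :=
    (Finset.measurable_restrict U) MeasurableSet.of_discrete
  change infinitePi coordProp _ = _
  rw [hset, ← Measure.map_apply measurable_decideFun hT, map_decideFun_infinitePi_coordProp,
    ← Measure.map_apply (Finset.measurable_restrict U) MeasurableSet.of_discrete,
    infinitePi_map_restrict, ← sum_measure_singleton]
  simp only [pi_singleton, coinBool_singleton, Finset.prod_const, Finset.card_univ,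
    Fintype.card_coe, Finset.sum_const, nsmul_eq_mul]

/-! ### Events determined by finitely many coordinates; cylinders -/

/-- `IsDetermined U E`: membership of an oracle in the event `E` depends only on its bits at the
strings of `U`. [folklore] -/
def IsDetermined (U : Finset (List Bool)) (E : Set (Set (List Bool))) : Prop :=
  ∀ ⦃A A' : Set (List Bool)⦄, restrictBool U A = restrictBool U A' → (A ∈ E ↔ A' ∈ E)

/-- The cylinder of the oracles whose bits on `U` are `τ` (Bennett–Gill: the oracles extending a
finite table). [folklore] -/
def oracleCylinder (U : Finset (List Bool)) (τ : U → Bool) : Set (Set (List Bool)) :=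
  {A | restrictBool U A = τ}

/-- Unfolding lemma for `oracleCylinder`. [folklore] -/
theorem mem_oracleCylinder_iff {U : Finset (List Bool)} {τ : U → Bool} {A : Set (List Bool)} :
    A ∈ oracleCylinder U τ ↔ restrictBool U A = τ :=
  Iff.rfl

/-- The trace of an event on the coordinates `U`: the bit patterns on `U` realised in `E`. [folklore] -/
def oracleTrace (U : Finset (List Bool)) (E : Set (Set (List Bool))) : Finset (U → Bool) :=
  open scoped Classical in Finset.univ.filter fun f => ∃ A ∈ E, restrictBool U A = f

/-- A determined event is the preimage of its trace. [folklore] -/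
theorem IsDetermined.eq_preimage_oracleTrace {U : Finset (List Bool)} {E : Set (Set (List Bool))}
    (hE : IsDetermined U E) : E = {A | restrictBool U A ∈ oracleTrace U E} := by
  ext A
  simp only [oracleTrace, Finset.mem_filter, Finset.mem_univ, true_and, Set.mem_setOf_eq]
  constructor
  · exact fun hA => ⟨A, hA, rfl⟩
  · rintro ⟨A', hA', h⟩
    exact (hE h).1 hA'

/-- Determined events are measurable. [folklore] -/
theorem IsDetermined.measurableSet {U : Finset (List Bool)} {E : Set (Set (List Bool))}
    (hE : IsDetermined U E) : MeasurableSet E := by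
  rw [hE.eq_preimage_oracleTrace]
  exact measurable_restrictBool U MeasurableSet.of_discrete

/-- The measure of a determined event is `|oracleTrace U E| · 2^{-|U|}`. [folklore] -/
theorem IsDetermined.measure_eq {U : Finset (List Bool)} {E : Set (Set (List Bool))}
    (hE : IsDetermined U E) : randomOracleMeasure E = (oracleTrace U E).card * 2⁻¹ ^ U.card := by
  conv_lhs => rw [hE.eq_preimage_oracleTrace]
  exact randomOracleMeasure_restrictBool U (oracleTrace U E)

/-- Cylinders over `U` are `U`-determined. [folklore] -/
theorem isDetermined_oracleCylinder (U : Finset (List Bool)) (τ : U → Bool) :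
    IsDetermined U (oracleCylinder U τ) :=
  fun A A' h => by simp only [oracleCylinder, Set.mem_setOf_eq, h]

/-- Cylinders are measurable. [folklore] -/
theorem measurableSet_oracleCylinder (U : Finset (List Bool)) (τ : U → Bool) :
    MeasurableSet (oracleCylinder U τ) :=
  (isDetermined_oracleCylinder U τ).measurableSet

/-- A cylinder over `U` has measure `2^{-|U|}`. [folklore] -/
theorem measure_oracleCylinder (U : Finset (List Bool)) (τ : U → Bool) :
    randomOracleMeasure (oracleCylinder U τ) = 2⁻¹ ^ U.card := by
  have : oracleCylinder U τ = {A | restrictBool U A ∈ ({τ} : Finset (U → Bool))} := by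
    ext A; simp [oracleCylinder]
  rw [this, randomOracleMeasure_restrictBool]; simp

/-- Cylinders have positive measure. [folklore] -/
theorem measure_oracleCylinder_ne_zero (U : Finset (List Bool)) (τ : U → Bool) :
    randomOracleMeasure (oracleCylinder U τ) ≠ 0 := by
  rw [measure_oracleCylinder]; exact pow_ne_zero _ (ENNReal.inv_ne_zero.2 ENNReal.ofNat_ne_top)

/-- Cylinders have finite measure. [folklore] -/
theorem measure_oracleCylinder_ne_top (U : Finset (List Bool)) (τ : U → Bool) :
    randomOracleMeasure (oracleCylinder U τ) ≠ ⊤ :=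
  measure_ne_top _ _

/-- Determination is monotone in the coordinate set. [folklore] -/
theorem IsDetermined.mono {U U' : Finset (List Bool)} {E : Set (Set (List Bool))}
    (hE : IsDetermined U E) (hU : U ⊆ U') : IsDetermined U' E := fun A A' h =>
  hE (funext fun u => by
    have := congrFun h ⟨u, hU u.2⟩
    simpa [restrictBool_apply] using this)

/-- Determined events are closed under intersection. [folklore] -/
theorem IsDetermined.inter {U : Finset (List Bool)} {E E' : Set (Set (List Bool))}
    (hE : IsDetermined U E) (hE' : IsDetermined U E') : IsDetermined U (E ∩ E') :=
  fun A A' h => by simp only [Set.mem_inter_iff, hE h, hE' h]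

/-- Determined events are closed under union. [folklore] -/
theorem IsDetermined.union {U : Finset (List Bool)} {E E' : Set (Set (List Bool))}
    (hE : IsDetermined U E) (hE' : IsDetermined U E') : IsDetermined U (E ∪ E') :=
  fun A A' h => by simp only [Set.mem_union, hE h, hE' h]

/-- Determined events are closed under complement. [folklore] -/
theorem IsDetermined.compl {U : Finset (List Bool)} {E : Set (Set (List Bool))}
    (hE : IsDetermined U E) : IsDetermined U Eᶜ :=
  fun A A' h => by simp only [Set.mem_compl_iff, hE h]

/-- Determined events are closed under difference. [folklore] -/
theorem IsDetermined.diff {U : Finset (List Bool)} {E E' : Set (Set (List Bool))}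
    (hE : IsDetermined U E) (hE' : IsDetermined U E') : IsDetermined U (E \ E') :=
  hE.inter hE'.compl

/-- The empty event is determined. [folklore] -/
theorem isDetermined_empty (U : Finset (List Bool)) : IsDetermined U ∅ := fun _ _ _ => Iff.rfl

/-- The sure event is determined. [folklore] -/
theorem isDetermined_univ (U : Finset (List Bool)) : IsDetermined U Set.univ :=
  fun _ _ _ => by simp

/-- The coordinate event `{A | u ∈ A}` is `{u}`-determined. [folklore] -/
theorem isDetermined_mem (u : List Bool) : IsDetermined {u} {A : Set (List Bool) | u ∈ A} := by
  intro A A' h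
  have := congrFun h ⟨u, Finset.mem_singleton_self u⟩
  simp only [restrictBool_apply] at this
  simp only [Set.mem_setOf_eq]
  rw [← @decide_eq_true_iff _ (Classical.propDecidable (u ∈ A)), this,
    @decide_eq_true_iff _ (Classical.propDecidable (u ∈ A'))]

/-- A determined event splits along its cylinders: for measurable `F`,
`μ (F ∩ E) = Σ_{τ ∈ oracleTrace U E} μ (F ∩ oracleCylinder U τ)`. [folklore] -/
theorem IsDetermined.measure_eq_sum {U : Finset (List Bool)} {E : Set (Set (List Bool))}
    (hE : IsDetermined U E) {F : Set (Set (List Bool))} (hF : MeasurableSet F) :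
    randomOracleMeasure (F ∩ E) = ∑ τ ∈ oracleTrace U E, randomOracleMeasure (F ∩ oracleCylinder U τ) := by
  have hdisj : Set.PairwiseDisjoint (↑(oracleTrace U E) : Set (U → Bool)) fun τ => F ∩ oracleCylinder U τ := by
    intro τ _ τ' _ hne
    refine Set.disjoint_left.2 fun A hA hA' => hne ?_
    exact hA.2.symm.trans hA'.2
  have hunion : F ∩ E = ⋃ τ ∈ oracleTrace U E, (F ∩ oracleCylinder U τ) := by
    ext A
    simp only [Set.mem_inter_iff, Set.mem_iUnion, exists_and_left, exists_prop]
    constructor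
    · rintro ⟨hF, hA⟩
      refine ⟨hF, restrictBool U A, ?_, rfl⟩
      rw [hE.eq_preimage_oracleTrace] at hA; exact hA
    · rintro ⟨hF, τ, hτ, hA⟩
      refine ⟨hF, ?_⟩
      rw [hE.eq_preimage_oracleTrace]
      show restrictBool U A ∈ oracleTrace U E
      rw [show restrictBool U A = τ from hA]; exact hτ
  rw [hunion, measure_biUnion_finset hdisj fun τ _ =>
    hF.inter (isDetermined_oracleCylinder U τ).measurableSet]

/-! ### Measurable cylinders are determined; the density lemma -/

/-- Mathlib's measurable cylinders of `List Bool → Prop` (= `Set (List Bool)`) are determined events: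
a cylinder over the finite coordinate set `s` is `s`-determined. (The measurable cylinders form a
ring of sets generating the product σ-algebra: Mathlib's `isSetRing_measurableCylinders`,
`generateFrom_measurableCylinders`.) [folklore] -/
theorem isDetermined_of_mem_measurableCylinders {T : Set (Set (List Bool))}
    (hT : T ∈ measurableCylinders fun _ : List Bool => Prop) : ∃ U : Finset (List Bool), IsDetermined U T := by
  obtain ⟨U, S, -, rfl⟩ := (mem_measurableCylinders T).1 hT
  refine ⟨U, fun A A' h => ?_⟩
  have hres : U.restrict (π := fun _ : List Bool => Prop) A = U.restrict (π := fun _ => Prop) A' := by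
    funext u
    have hu := congrFun h u
    simp only [restrictBool_apply] at hu
    exact propext ((@decide_eq_decide _ _ (Classical.propDecidable _) (Classical.propDecidable _)).1 hu)
  change U.restrict (π := fun _ : List Bool => Prop) A ∈ S ↔ U.restrict (π := fun _ => Prop) A' ∈ S
  rw [hres]

/-- **Density lemma** (the Lebesgue-density step of Bennett–Gill's argument): an event of positive
measure is, for every `δ > 0`, all of some cylinder up to a `δ`-fraction of it:
`μ (oracleCylinder U τ \ E) ≤ δ · μ (oracleCylinder U τ)`. Proof: approximate `E` by a measurable
cylinder `T` with `μ (T ∆ E) < δ μ(E)/2` (Mathlib) and pigeonhole over the `oracleCylinder`s of `T`.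
[cite: BookVollmerWagner1996, §4 Thm. 3 (p. 374, ALMOST-𝒦 ⊆ BP²𝒦)] -/
theorem exists_oracleCylinder_diff_le {E : Set (Set (List Bool))} (hE : MeasurableSet E)
    (hpos : randomOracleMeasure E ≠ 0) {δ : ℝ≥0∞} (hδ : δ ≠ 0) :
    ∃ (U : Finset (List Bool)) (τ : U → Bool),
      randomOracleMeasure (oracleCylinder U τ \ E) ≤ δ * randomOracleMeasure (oracleCylinder U τ) := by
  set μ := randomOracleMeasure with hμ
  rcases le_or_gt 1 δ with hδ1 | hδ1
  · refine ⟨∅, fun _ => true, ?_⟩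
    calc μ (oracleCylinder ∅ (fun _ => true) \ E) ≤ μ (oracleCylinder ∅ fun _ => true) :=
          measure_mono fun A hA => hA.1
      _ = 1 * μ (oracleCylinder ∅ fun _ => true) := (one_mul _).symm
      _ ≤ δ * μ (oracleCylinder ∅ fun _ => true) := by gcongr
  set m := μ E with hm
  have hmtop : m ≠ ⊤ := measure_ne_top _ _
  set ε := δ * (m / 2) with hε
  have hεpos : 0 < ε := ENNReal.mul_pos hδ (ENNReal.div_ne_zero.2 ⟨hpos, ENNReal.ofNat_ne_top⟩)
  obtain ⟨T, hTc, hT⟩ := exists_measure_symmDiff_lt_of_generateFrom_isSetRing (μ := μ)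
    (isSetRing_measurableCylinders (α := fun _ : List Bool => Prop))
    ⟨{Set.univ}, Set.countable_singleton _,
      fun F hF => by rw [Set.mem_singleton_iff.1 hF]; exact univ_mem_measurableCylinders _, by simp⟩
    generateFrom_measurableCylinders.symm hE hεpos
  obtain ⟨U, hU⟩ := isDetermined_of_mem_measurableCylinders hTc
  have hTm : MeasurableSet T := hU.measurableSet
  have h1 : μ (T \ E) < ε := (measure_mono fun A hA => Or.inl hA).trans_lt hT
  have h2 : μ (E \ T) < ε := (measure_mono fun A hA => Or.inr hA).trans_lt hT
  have hεle : ε ≤ m / 2 := by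
    calc ε = δ * (m / 2) := rfl
      _ ≤ 1 * (m / 2) := by gcongr
      _ = m / 2 := one_mul _
  have hT2 : m / 2 ≤ μ T := by
    have h3 : m ≤ μ T + ε := by
      calc m = μ (E ∩ T) + μ (E \ T) := (measure_inter_add_sdiff E hTm).symm
        _ ≤ μ T + ε := add_le_add (measure_mono Set.inter_subset_right) h2.le
    calc m / 2 = m - m / 2 := (ENNReal.sub_half hmtop).symm
      _ ≤ m - ε := tsub_le_tsub_left hεle m
      _ ≤ μ T := tsub_le_iff_right.2 h3
  by_contra hcon
  push Not at hcon
  have hsum1 : ∑ τ ∈ oracleTrace U T, μ (oracleCylinder U τ \ E) = μ (T \ E) := by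
    have := hU.measure_eq_sum hE.compl
    rw [Set.inter_comm, ← Set.sdiff_eq] at this
    rw [this]
    refine Finset.sum_congr rfl fun τ _ => ?_
    rw [Set.inter_comm, Set.sdiff_eq]
  have hsum2 : ∑ τ ∈ oracleTrace U T, μ (oracleCylinder U τ) = μ T := by
    have := hU.measure_eq_sum MeasurableSet.univ
    rw [Set.univ_inter] at this
    rw [this]
    exact Finset.sum_congr rfl fun τ _ => by rw [Set.univ_inter]
  have hne : (oracleTrace U T).Nonempty := by
    rw [Finset.nonempty_iff_ne_empty]
    intro h0
    have : μ T = 0 := by rw [← hsum2, h0, Finset.sum_empty]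
    rw [this] at hT2
    have : m / 2 = 0 := le_antisymm hT2 bot_le
    exact (ENNReal.div_ne_zero.2 ⟨hpos, ENNReal.ofNat_ne_top⟩) this
  have hlt : δ * μ T < ε := by
    calc δ * μ T = ∑ τ ∈ oracleTrace U T, δ * μ (oracleCylinder U τ) := by rw [← Finset.mul_sum, hsum2]
      _ < ∑ τ ∈ oracleTrace U T, μ (oracleCylinder U τ \ E) :=
          ENNReal.sum_lt_sum_of_nonempty hne fun τ _ => hcon U τ
      _ = μ (T \ E) := hsum1
      _ < ε := h1
  have : μ T < m / 2 := by
    rw [hε] at hlt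
    exact (ENNReal.mul_lt_mul_iff_right hδ (lt_of_lt_of_le hδ1 le_top |>.ne_top)).1 hlt
  exact absurd hT2 (not_le.2 this)

/-- The density lemma in conditional form: some cylinder `C` has `μ (E ∩ C) ≥ (1 - δ) · μ C`. [folklore] -/
theorem exists_oracleCylinder_inter_ge {E : Set (Set (List Bool))} (hE : MeasurableSet E)
    (hpos : randomOracleMeasure E ≠ 0) {δ : ℝ≥0∞} (hδ : δ ≠ 0) :
    ∃ (U : Finset (List Bool)) (τ : U → Bool),
      (1 - δ) * randomOracleMeasure (oracleCylinder U τ) ≤ randomOracleMeasure (E ∩ oracleCylinder U τ) := by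
  obtain ⟨U, τ, h⟩ := exists_oracleCylinder_diff_le hE hpos hδ
  refine ⟨U, τ, ?_⟩
  have hsplit : randomOracleMeasure (oracleCylinder U τ) =
      randomOracleMeasure (oracleCylinder U τ ∩ E) + randomOracleMeasure (oracleCylinder U τ \ E) :=
    (measure_inter_add_sdiff _ hE).symm
  rw [Set.inter_comm]
  calc (1 - δ) * randomOracleMeasure (oracleCylinder U τ)
        = randomOracleMeasure (oracleCylinder U τ) - δ * randomOracleMeasure (oracleCylinder U τ) := by
          rw [ENNReal.sub_mul fun _ _ => measure_oracleCylinder_ne_top U τ, one_mul]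
    _ ≤ randomOracleMeasure (oracleCylinder U τ) - randomOracleMeasure (oracleCylinder U τ \ E) :=
          tsub_le_tsub_left h _
    _ ≤ randomOracleMeasure (oracleCylinder U τ ∩ E) := by
          rw [hsplit, ENNReal.add_sub_cancel_right (measure_ne_top _ _)]

end Literature.Computability.QuantumComplexity

end
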